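import Mathlib
import Summits.NavierStokesRegularity.NavierStokesRegularity.Theorems.EulerZoomLiouvillePowerGaugeEulerLiouvilleSwirlCapacityEndgameDoors
import Summits.NavierStokesRegularity.NavierStokesRegularity.Theorems.EulerZoomLiouvillePowerGaugeEulerLiouvilleSwirlCapacityTransport
import Summits.NavierStokesRegularity.NavierStokesRegularity.Theorems.EulerZoomLiouvillePowerGaugeEulerLiouvilleSwirlCapacityAxisFloor
import HarnessLib

/-!
# Crux `EulerZoomLiouville.PowerGaugeEulerLiouville` (stmt-NavierStokesRegularity-19832), line `swirl-capacity`: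
# THE SWIRLING SLOW-DRIFT STRATUM IS EMPTY — member-level assembly D1 ∘ D2_pow ∘ D2′_pow ∘ D3_pow, all by name

Route №10 `EulerZoomLiouville` (NavierStokesRegularity), crux E.  Line `swirl-capacity` (ideator ns-idea-11 g3;
`Cruxes/PowerGaugeEulerLiouville/Lines/swirl_capacity.lean`, rev 2).  With the four pieces in the tree —
D1 `swirlBlobsPersist_of_axiDriftingWith` (`…SwirlCapacityTransport`, ns-sfl-p1: swirl superlevel blobs persist backward, the swirl
`Γ = r u_θ` being materially conserved), D2_pow `axisCapacityFloorPow` (`…SwirlCapacityAxisFloor`, ns-cas-k2: the power-lossy axis capacity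
floor `∫_{B(3A)} ‖∇f‖²/r² ≥ K_q γ₀² (V/A³)^{2/q} / A` for every `q ≥ 2`), and D2′_pow ∘ D3_pow `swirlEndgamePow` (`…SwirlCapacityEndgameDoors`,
this seat: the power-tolerant endgame) — the stratum statement of the line is a tree theorem with no hypothesis left over:

* `ae_eq_zero_of_gauge_of_swirlingSlowDrifting` — in the window `0 < ρ ≤ 1/2`, a member of Seregin's power-gauged ancient Euler class
  (suitable weak solution on `(−∞,0) × ℝ³`, weak spatial gradient, the `A`/`E`/`D` power gauges) which is CLASSICAL and AXISYMMETRIC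
  (velocity and pressure slices) with the backward drift bound `‖u(τ,x)‖ ≤ M (−τ)^{−κ}`, `(1−ρ)/(2−ρ) < κ < 1`, and which carries SWIRL at
  some past point (`swirl (u τ₀) x₁ ≠ 0`, `τ₀ < 0`) vanishes a.e. — i.e. no such member exists (convenient binders);
* **`swirlingSlowDrifting_ae_eq_zero`** — the same in the skeleton's binder shape
  `∀ ρ, 0 < ρ → ρ ≤ 1/2 → ∀ u p H c, InClass ρ u p H c → IsSwirlingSlowDrifting ρ u p → u =ᵐ 0` with `InClass` and
  `IsSwirlingSlowDrifting ρ u p := ∃ M κ, (1−ρ)/(2−ρ) < κ ∧ IsAxiDriftingWith u p M κ ∧ HasPastSwirl u` δ-UNFOLDED verbatim from the line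
  file (the lead wires `stub_swirlingSlowDrifting` by `exact`).

Together with LINE A (`casimir-floor`, `CasimirFloor.ae_eq_zero_of_gauge_of_swirlFreeSlowDrifting`: the swirl-FREE slow-drifting classical
axisymmetric members are trivial) this exhausts the classical axisymmetric members with drift exponent `κ ∈ ((1−ρ)/(2−ρ), 1)`.  The residue
D4 of the line (non-classical / non-axisymmetric / fast drift `κ ≤ (1−ρ)/(2−ρ)`) is the crux minus the stratum and stays OPEN.

WHAT THIS IS NOT: not NS, not the crux — a helper `--supports` stmt-19832 (a stratum of a hypothetical class of ancient Euler solutions is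
shown empty; MODEL lattice); no summit statement is proved here.
[cite: MajdaBertozziCUP2002, §2.3.3 (2.67); CaffarelliKohnNirenberg1982, §2]
-/

noncomputable section

-- flat `Theorems/<Route><Decl>…` files of one crux share the namespace of the crux (tree convention)
set_option linter.dupNamespace false

open MeasureTheory Set Filter Topology Metric Function
open scoped NNReal ENNReal

namespace Summit.NavierStokesRegularity.NavierStokesRegularity.Theorems.PowerGaugeEulerLiouville.SwirlCapacity

open Literature.Analysis Literature.Analysis.FluidPDE

variable {u : ℝ → EuclideanSpace ℝ (Fin 3) → EuclideanSpace ℝ (Fin 3)} {p : ℝ → EuclideanSpace ℝ (Fin 3) → ℝ}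
  {H : ℝ → EuclideanSpace ℝ (Fin 3) → EuclideanSpace ℝ (Fin 3) →L[ℝ] EuclideanSpace ℝ (Fin 3)} {c : ℝ≥0}

/-- **The swirling slow-drift stratum of crux E is empty** (convenient binders): window `0 < ρ ≤ 1/2`, Seregin's three class hypotheses,
classical axisymmetric slices, drift bound `‖u(τ,x)‖ ≤ M(−τ)^{−κ}` with `(1−ρ)/(2−ρ) < κ < 1`, and swirl at one past point force `u = 0` a.e.
(hence, honestly: are contradictory).  Assembly by name: D1 `swirlBlobsPersist_of_axiDriftingWith` ∘ D2_pow `axisCapacityFloorPow` ∘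
`swirlEndgamePow`. [cite: MajdaBertozziCUP2002, §2.3.3 (2.67); CaffarelliKohnNirenberg1982, §2] -/
theorem ae_eq_zero_of_gauge_of_swirlingSlowDrifting {ρ : ℝ} (hρ : 0 < ρ) (hρh : ρ ≤ 1 / 2)
    (hsw : IsSuitableWeakSolutionOn (slab (EuclideanSpace ℝ (Fin 3)) (Iio 0) isOpen_Iio) 0 0 u p)
    (hH : HasWeakSpatialGradientOn (slab (EuclideanSpace ℝ (Fin 3)) (Iio 0) isOpen_Iio) u H)
    (hgauge : ∀ a : ℝ, 0 < a →
      ENNReal.ofReal (a ^ (2 * ρ)) * cknA a (0 : ℝ × EuclideanSpace ℝ (Fin 3)) u +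
          ENNReal.ofReal (a ^ ρ) * cknE a (0 : ℝ × EuclideanSpace ℝ (Fin 3)) H +
        ENNReal.ofReal (a ^ (2 * ρ)) * cknD a (0 : ℝ × EuclideanSpace ℝ (Fin 3)) p ≤ (c : ℝ≥0∞))
    (hcl : IsClassicalEulerSolutionOn (Iio 0) 0 u p)
    (hsym : ∀ τ : ℝ, τ < 0 → IsAxisymmetric (u τ) ∧ IsAxisymmetricScalar (p τ))
    {M κ : ℝ} (hκρ : (1 - ρ) / (2 - ρ) < κ) (hκ1 : κ < 1)
    (hM : ∀ τ : ℝ, τ < 0 → ∀ x : EuclideanSpace ℝ (Fin 3), ‖u τ x‖ ≤ M * (-τ) ^ (-κ))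
    {τ₀ : ℝ} (hτ₀ : τ₀ < 0) {x₁ : EuclideanSpace ℝ (Fin 3)} (hx₁ : swirl (u τ₀) x₁ ≠ 0) :
    uncurry u =ᵐ[volume.restrict (Iio (0 : ℝ) ×ˢ (univ : Set (EuclideanSpace ℝ (Fin 3))))] 0 := by
  -- `M ≥ 0` is forced by the drift bound at `τ = -1`
  have hM0 : 0 ≤ M := by
    have h := hM (-1) (by norm_num) 0
    rw [neg_neg, Real.one_rpow, mul_one] at h
    exact (norm_nonneg _).trans h
  have hW : IsClassicalEulerSolutionOn (Set.Iio 0) 0 u p ∧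
      (∀ τ : ℝ, τ < 0 → IsAxisymmetric (u τ) ∧ IsAxisymmetricScalar (p τ)) ∧
      0 ≤ M ∧ κ < 1 ∧ ∀ τ : ℝ, τ < 0 → ∀ x : EuclideanSpace ℝ (Fin 3), ‖u τ x‖ ≤ M * (-τ) ^ (-κ) :=
    ⟨hcl, hsym, hM0, hκ1, hM⟩
  exact swirlEndgamePow axisCapacityFloorPow ρ hρ hρh u p H c ⟨hsw, hH, hgauge⟩ M κ hκρ hW ⟨τ₀, hτ₀, x₁, hx₁⟩
    (swirlBlobsPersist_of_axiDriftingWith u p M κ hW)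

/-- **The stratum statement in the skeleton's binder shape** (`InClass ρ u p H c → IsSwirlingSlowDrifting ρ u p → VanishesAE u`, window
`0 < ρ ≤ 1/2`, every line `def` δ-unfolded verbatim): SLOW-DRIFTING CLASSICAL AXISYMMETRIC MEMBERS CARRY NO SWIRL — and, carrying swirl by
hypothesis, do not exist; formally `u = 0` a.e.  One-name filler for the lead's `stub_swirlingSlowDrifting`.
[cite: MajdaBertozziCUP2002, §2.3.3 (2.67); CaffarelliKohnNirenberg1982, §2] -/
theorem swirlingSlowDrifting_ae_eq_zero :
    ∀ ρ : ℝ, 0 < ρ → ρ ≤ 1 / 2 →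
      ∀ (u : ℝ → EuclideanSpace ℝ (Fin 3) → EuclideanSpace ℝ (Fin 3)) (p : ℝ → EuclideanSpace ℝ (Fin 3) → ℝ)
        (H : ℝ → EuclideanSpace ℝ (Fin 3) → EuclideanSpace ℝ (Fin 3) →L[ℝ] EuclideanSpace ℝ (Fin 3)) (c : ℝ≥0),
        (IsSuitableWeakSolutionOn (slab (EuclideanSpace ℝ (Fin 3)) (Set.Iio 0) isOpen_Iio) 0 0 u p ∧
            HasWeakSpatialGradientOn (slab (EuclideanSpace ℝ (Fin 3)) (Set.Iio 0) isOpen_Iio) u H ∧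
            (∀ a : ℝ, 0 < a →
              ENNReal.ofReal (a ^ (2 * ρ)) * cknA a (0 : ℝ × EuclideanSpace ℝ (Fin 3)) u +
                    ENNReal.ofReal (a ^ ρ) * cknE a (0 : ℝ × EuclideanSpace ℝ (Fin 3)) H +
                  ENNReal.ofReal (a ^ (2 * ρ)) * cknD a (0 : ℝ × EuclideanSpace ℝ (Fin 3)) p ≤ (c : ℝ≥0∞))) →
          (∃ M κ : ℝ, (1 - ρ) / (2 - ρ) < κ ∧
              (IsClassicalEulerSolutionOn (Set.Iio 0) 0 u p ∧
                  (∀ τ : ℝ, τ < 0 → IsAxisymmetric (u τ) ∧ IsAxisymmetricScalar (p τ)) ∧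
                  0 ≤ M ∧ κ < 1 ∧ ∀ τ : ℝ, τ < 0 → ∀ x : EuclideanSpace ℝ (Fin 3), ‖u τ x‖ ≤ M * (-τ) ^ (-κ)) ∧
              (∃ τ₀ : ℝ, τ₀ < 0 ∧ ∃ x : EuclideanSpace ℝ (Fin 3), swirl (u τ₀) x ≠ 0)) →
            Function.uncurry u =ᵐ[volume.restrict (Set.Iio (0 : ℝ) ×ˢ (Set.univ : Set (EuclideanSpace ℝ (Fin 3))))] 0 := by
  intro ρ hρ hρh u p H c h hS
  obtain ⟨M, κ, hκ, hW, hsw⟩ := hS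
  exact swirlEndgamePow axisCapacityFloorPow ρ hρ hρh u p H c h M κ hκ hW hsw (swirlBlobsPersist_of_axiDriftingWith u p M κ hW)

end Summit.NavierStokesRegularity.NavierStokesRegularity.Theorems.PowerGaugeEulerLiouville.SwirlCapacity

end
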